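import Mathlib
import HarnessLib
import Summits.ValiantsHypothesis.ValiantsHypothesis.Theses.SchenstedIndex
import Summits.ValiantsHypothesis.ValiantsHypothesis.Theorems.SchenstedIndexPowTraceCertificateTools

/-!
# Route SchenstedIndex — crux `PowTraceCertificate` (stmt-ValiantsHypothesis-15995) PROVED

The crux `Summit.ValiantsHypothesis.ValiantsHypothesis.Theses.SchenstedIndex.PowTraceCertificate`
(rank-3 crux of the OPEN route SchenstedIndex; "the sector certificate in REPRESENTATION form") says:
for `m ≥ 1` and all `e, t`, if the 1-factorisation indicator `1_OF(t,m)` of the `m`-block partitions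
of the slot set `S = Fin t × Fin m × Fin m` is NOT in the span `span_(m+e)(t,m)` of the block-cycle
vectors `v_X(π) = ∏_(B ∈ π) ∑_(q : Fin m ≃ B) ∏_i X (q i) (q (i+1))` of the slot matrices `X` of rank
`≤ m + e`, then no `(m+e) × (m+e)` matrix `A` of linear forms in the `m²` variables `x_(i,j)` has
`tr(A^m) = per_m`.

PROOF (the soundness lemma of the certificate; slot polarisation, following the crux idea card
`Cruxes/PowTraceCertificate/Ideas/slot-polarisation-imm-pullback.md` and the refuter vetting of
2026-08-17; tools in `Theorems/SchenstedIndexPowTraceCertificateTools.lean`). Let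
`θ : ℂ[x_(i,j)] → ℂ[y_s]` be the algebra map `x_(i,j) ↦ ∑_k y_(k,i,j)` and, for a block `B ⊆ S` of
size `m`, let `E_B(F)` be the coefficient of the square-free monomial `y^B` in `F`.
* `E_B(θ per_m) = [B has m distinct rows and m distinct columns]` (`coeff_indicator_theta_perPoly`),
  so `π ↦ ∏_(B ∈ π) E_B(θ per_m)` IS the indicator `1_OF`.
* `θ(tr A^m) = tr(Ã^m)` for the slot pencil `Ã = ∑_s y_s N_s`, `N_(k,i,j) := ∂A/∂x_(i,j)`
  (`map_theta_eq_pencil`), and `E_B(tr Ã^m) = ∑_v ∑_(q : Fin m ≃ B) ∏_i (N_(q i))_(v i, v (i+1))`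
  (`coeff_indicator_trace_pencil_pow`, closed walks).
* Fubini over the blocks of `π` (`sum_prod_parts_eq_prod_sum`) and the reindexing `v = ρ ∘ q` give
  `∏_(B ∈ π) E_B(tr Ã^m) = ∑_(ρ : S → Fin n) v_(X_ρ)(π)` with the slot matrices
  `X_ρ(s,s') := (N_s)_(ρ s, ρ s')` of rank `≤ n` (`rank_slotMatrix_le`).
So `tr(A^m) = per_m` forces `1_OF = ∑_ρ v_(X_ρ) ∈ span_(m+e)(t,m)` — the contrapositive of the crux.
No duality, no orbit closures, no multiplicities.

HONEST FRAMING: this is the SOUNDNESS direction of the route's certificate scheme (finite linear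
algebra); all lower-bound content of route SchenstedIndex stays in its crux #2
`OneFactorisationBandLimit` (open). Nothing here bears on `VP ≠ VNP`.
-/

set_option linter.dupNamespace false

noncomputable section

namespace Summit.ValiantsHypothesis.ValiantsHypothesis.Theorems.SchenstedIndex

open MvPolynomial
open Literature.Computability.AlgebraicComplexity

/-! ## 7. The certificate -/

/-- **`PowTraceCertificate` (stmt-ValiantsHypothesis-15995) holds.** If the 1-factorisation
indicator `1_OF(t,m)` is not in `span_(m+e)(t,m)`, then no `(m+e) × (m+e)` matrix of linear forms
`A` has `tr(A^m) = per_m`: otherwise, polarising both sides and taking square-free block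
coefficients, `1_OF = ∑_(ρ : S → Fin (m+e)) v_(X_ρ)` with every slot matrix `X_ρ` of rank `≤ m+e`. -/
theorem powTraceCertificate_proof :
    Summit.ValiantsHypothesis.ValiantsHypothesis.Theses.SchenstedIndex.PowTraceCertificate := by
  intro m e t hm hnot A hA htr
  classical
  apply hnot
  -- the polarisation `θ : x_ℓ ↦ ∑_k y_(k,ℓ)` and the slot pencil coefficients `N_s = ∂A/∂x_(label s)`
  set θ : MvPolynomial (Fin m × Fin m) ℂ →ₐ[ℂ] MvPolynomial (Fin t × Fin m × Fin m) ℂ :=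
    aeval (fun ℓ : Fin m × Fin m => ∑ k : Fin t,
      (X (k, ℓ) : MvPolynomial (Fin t × Fin m × Fin m) ℂ)) with hθ
  set N : Fin t × Fin m × Fin m → Matrix (Fin (m + e)) (Fin (m + e)) ℂ :=
    fun s => Matrix.of fun a b => coeff (Finsupp.single s.2 1) (A a b) with hN
  have hm0 : 0 < m := hm
  -- polarise the representation: `tr(Ã^m) = θ(per_m)`
  have hpol : ((Matrix.of fun a b : Fin (m + e) => ∑ s : Fin t × Fin m × Fin m,
      C (N s a b) * (X s : MvPolynomial (Fin t × Fin m × Fin m) ℂ)) ^ m).trace =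
      θ (perPoly (Fin m) ℂ) := by
    rw [← htr, AddMonoidHom.map_trace θ, ← AlgHom.mapMatrix_apply, map_pow, AlgHom.mapMatrix_apply,
      hθ, map_theta_eq_pencil A hA]
    rfl
  -- block by block: the per side is the indicator, the trace side is the closed-walk sum
  have hblock : ∀ (π : {π : Finpartition (Finset.univ : Finset (Fin t × Fin m × Fin m)) //
      ∀ B ∈ π.parts, B.card = m})
      [Decidable (∀ B ∈ π.1.parts,
        (B.image fun s => s.2.1).card = m ∧ (B.image fun s => s.2.2).card = m)],
      (if ∀ B ∈ π.1.parts, (B.image fun s => s.2.1).card = m ∧ (B.image fun s => s.2.2).card = m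
        then (1 : ℂ) else 0) =
      ∑ ρ : Fin t × Fin m × Fin m → Fin (m + e), ∏ B ∈ π.1.parts, ∑ q : Fin m ≃ ↥B,
        ∏ i : Fin m, (Matrix.of fun s s' => N s (ρ s) (ρ s')) (q i).1 (q (finRotate m i)).1 := by
    intro π _
    -- per side: `∏_B coeff_(y^B) θ(per_m)` is the indicator
    have hE : (if ∀ B ∈ π.1.parts, (B.image fun s => s.2.1).card = m ∧
        (B.image fun s => s.2.2).card = m then (1 : ℂ) else 0) =
        ∏ B ∈ π.1.parts, coeff (∑ s ∈ B, Finsupp.single s 1) (θ (perPoly (Fin m) ℂ)) := by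
      have hθB : ∀ B ∈ π.1.parts, coeff (∑ s ∈ B, Finsupp.single s 1) (θ (perPoly (Fin m) ℂ)) =
          if (B.image fun s => s.2.1).card = m ∧ (B.image fun s => s.2.2).card = m
            then (1 : ℂ) else 0 := fun B hB => by
        rw [hθ]; exact coeff_indicator_theta_perPoly B (π.2 B hB)
      rw [Finset.prod_congr rfl hθB, Finset.prod_boole]
      by_cases h : ∀ B ∈ π.1.parts, (B.image fun s => s.2.1).card = m ∧
          (B.image fun s => s.2.2).card = m
      · rw [if_pos h, if_pos h]
      · rw [if_neg h, if_neg h]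
    rw [hE, ← hpol]
    -- trace side, block by block
    rw [Finset.prod_congr rfl (fun B hB =>
      coeff_indicator_trace_pencil_pow hm0 N B (π.2 B hB))]
    -- Fubini over the blocks on the right-hand side
    have hF := sum_prod_parts_eq_prod_sum π.1
      (fun (B : Finset (Fin t × Fin m × Fin m)) (r : ↥B → Fin (m + e)) =>
        ∑ q : Fin m ≃ ↥B, ∏ i : Fin m, N (q i) (r (q i)) (r (q (finRotate m i))))
    refine Eq.trans ?_ (hF.symm.trans ?_)
    · refine Finset.prod_congr rfl fun B _ => ?_
      change (∑ v : Fin m → Fin (m + e), ∑ q : Fin m ≃ ↥B,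
          ∏ i : Fin m, N (q i) (v i) (v (finRotate m i))) =
        ∑ r : ↥B → Fin (m + e), ∑ q : Fin m ≃ ↥B,
          ∏ i : Fin m, N (q i) (r (q i)) (r (q (finRotate m i)))
      rw [Finset.sum_comm]
      conv_rhs => rw [Finset.sum_comm]
      refine Finset.sum_congr rfl fun q _ => ?_
      exact (sum_arrow_eq_sum_comp q (fun v => ∏ i : Fin m, N (q i) (v i) (v (finRotate m i)))).symm
    · rfl
  -- hence the indicator is the sum of the block-cycle vectors of the slot matrices `X_ρ`
  have hmem : ∀ ρ : Fin t × Fin m × Fin m → Fin (m + e),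
      (fun π : {π : Finpartition (Finset.univ : Finset (Fin t × Fin m × Fin m)) //
          ∀ B ∈ π.parts, B.card = m} =>
        ∏ B ∈ π.1.parts, ∑ q : Fin m ≃ ↥B,
          ∏ i : Fin m, (Matrix.of fun s s' => N s (ρ s) (ρ s')) (q i).1 (q (finRotate m i)).1) ∈
      Submodule.span ℂ (Set.range fun X : {X : Matrix (Fin t × Fin m × Fin m)
          (Fin t × Fin m × Fin m) ℂ // X.rank ≤ m + e} =>
        fun π : {π : Finpartition (Finset.univ : Finset (Fin t × Fin m × Fin m)) //
            ∀ B ∈ π.parts, B.card = m} =>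
          ∏ B ∈ π.1.parts, ∑ q : Fin m ≃ ↥B, ∏ i : Fin m, X.1 (q i).1 (q (finRotate m i)).1) :=
    fun ρ => Submodule.subset_span
      ⟨⟨Matrix.of fun s s' => N s (ρ s) (ρ s'), rank_slotMatrix_le N ρ⟩, rfl⟩
  convert Submodule.sum_mem _ (fun ρ (_ : ρ ∈ (Finset.univ :
    Finset (Fin t × Fin m × Fin m → Fin (m + e)))) => hmem ρ) using 1
  funext π
  rw [Finset.sum_apply]
  exact hblock π

end Summit.ValiantsHypothesis.ValiantsHypothesis.Theorems.SchenstedIndex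

end
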